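import Literature.Probability.RandomPlanarGeometry.HexSAWBrickWallStripFugacityWidthOneContactCLT
import HarnessLib

/-!
# The two-fugacity strip partition function at COMPLEX fugacity and the characteristic function of the contact law

Topic `Literature/Probability/RandomPlanarGeometry` (continues `…WidthOneContactCLT.lean`: `finLaw`, `contactLaw y z N` = the law of `(bc − N b)/√N` under
`P_{N,y,z}`, `integral_exp_mul_contactLaw` = its REAL moment generating function as a quotient of partition functions).  The Berry–Esseen rate and the
local limit theorem for the contact number (DOOR-ap5-g27 item 1/2) need the CHARACTERISTIC FUNCTION, i.e. the partition function at the complex fugacity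
`y e^{iθ/√N}`.  THIS FILE sets up exactly that object and identity (definitions + plumbing, no asymptotics):

* §1 `integral_finLaw_complex` (`∫ f d(finLaw) = Σ w f(X)` for complex-valued `f`), `charFun_finLaw` (`φ(t) = Σ_q w(q) e^{itX(q)}`).
* §2 `stripZ₂C T n w v = Σ_p w^{bc} v^{tc}` — `C_{T,n}` with fugacities in any commutative semiring (here `ℂ`); `stripZ₂C_real` / `stripZ₂C_ofReal`
  (agrees with `stripZ₂` on real arguments), `norm_stripZ₂C_le` (`‖C_{T,n}(w,v)‖ ≤ C_{T,n}(‖w‖,‖v‖)`), `stripZ₂C_one_tilt_eq_sum` (`C_{1,N}(y e^u, z) = Σ_q wgt_{y,z}(q) e^{u·bc(q)}`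
  for complex `u`).
* §3 ★★ `charFun_contactLaw`: for `y, z > 0` and every real `t`,
  `φ_{contactLaw y z N}(t) = C_{1,N}(y e^{it/√N}, z)/C_{1,N}(y,z) · e^{−it√N b(y,z)}` — the complex twin of `integral_exp_mul_contactLaw`; with
  `Literature/Probability/Independence/BerryEsseenComplexTilt.lean` + `BerryEsseenMajorant.lean` the Berry–Esseen rate for the contact number is thereby
  reduced to complex two-term asymptotics of `stripZ₂C 1 N (y e^u) z` for `|u| ≤ ρ`.

## Sources
N. R. Beaton, M. Bousquet-Mélou, J. de Gier, H. Duminil-Copin, A. J. Guttmann, CMP 326 (2014), arXiv:1109.0358v5 §3.2 (p. 10: the weights `y^{bc} z^{tc}`,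
`C_{T,N}(y,z)` — a polynomial, here evaluated at complex arguments); R. Durrett, *Probability: Theory and Examples* (2019) §3.3 (characteristic functions;
Theorem 3.3.1).  Lane statements (lane «pcv-sawmu», a-p5 g27); nothing is quoted AS PRINTED.
-/

noncomputable section

open MeasureTheory ProbabilityTheory Filter Finset Complex
open Literature.Probability.LatticeModels Literature.Probability.Percolation
open scoped Topology

namespace Literature.Probability.RandomPlanarGeometry.SAW.HexBW

namespace WidthOneYZ

variable {y z : ℝ}

/-! ## §1 Complex test functions against a finitely supported law; its characteristic function -/

/-- `∫ f d(finLaw S w X) = Σ_{q ∈ S} w(q)·f(X q)` for every COMPLEX-valued `f` (`w ≥ 0` on `S`). [cite: Durrett2019, §3.3 (lane plumbing)] -/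
theorem integral_finLaw_complex {ι : Type*} (S : Finset ι) {w : ι → ℝ} (X : ι → ℝ) (hw : ∀ q ∈ S, 0 ≤ w q) (f : ℝ → ℂ) :
    ∫ x, f x ∂finLaw S w X = ∑ q ∈ S, (w q : ℂ) * f (X q) := by
  rw [finLaw, integral_finsetSum_measure fun q _ => (integrable_dirac (by simp)).smul_measure ENNReal.ofReal_ne_top]
  refine Finset.sum_congr rfl fun q hq => ?_
  rw [integral_smul_measure, integral_dirac, ENNReal.toReal_ofReal (hw q hq), Complex.real_smul]

/-- **The characteristic function of a finitely supported law**: `φ_{finLaw S w X}(t) = Σ_{q ∈ S} w(q) e^{i t X(q)}`.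
[cite: Durrett2019, §3.3 Theorem 3.3.1 (characteristic functions; lane plumbing)] -/
theorem charFun_finLaw {ι : Type*} (S : Finset ι) {w : ι → ℝ} (X : ι → ℝ) (hw : ∀ q ∈ S, 0 ≤ w q) (t : ℝ) :
    charFun (finLaw S w X) t = ∑ q ∈ S, (w q : ℂ) * cexp ((t : ℂ) * (X q : ℂ) * I) := by
  rw [charFun_apply_real, integral_finLaw_complex S X hw]

/-! ## §2 The partition function at complex fugacities -/

/-- **`C_{T,n}(w, v) = Σ_p w^{bc(p)} v^{tc(p)}` with fugacities in ANY commutative semiring `R`** — the two-fugacity polynomial of the strip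
evaluated in `R` (`R = ℝ` is the tree's `stripZ₂`, `R = ℂ` is the complex-fugacity partition function of the Berry–Esseen / local-limit programme,
`R = ℝ[X]`-type instances give generating polynomials). [cite: BeatonBousquetMelouDeGierDuminilCopinGuttmann2014, §3.2 (arXiv v5 p. 10: C_{T,N}(y,z) = Σ y^{bc} z^{tc})] -/
def stripZ₂C {R : Type*} [CommSemiring R] (T n : ℕ) (w v : R) : R :=
  ∑ p ∈ stripPairs T n, w ^ bottomVisits₀ p.1 p.2 n * v ^ topVisits₀ T p.1 p.2 n

/-- In `R = ℝ` this is the tree's `stripZ₂` (definitionally). [cite: BeatonBousquetMelouDeGierDuminilCopinGuttmann2014, §3.2 (lane plumbing)] -/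
theorem stripZ₂C_real (T n : ℕ) (y z : ℝ) : stripZ₂C T n y z = stripZ₂ T n y z := rfl

/-- On real arguments cast to `ℂ`, `stripZ₂C` is the cast of `stripZ₂`. [cite: BeatonBousquetMelouDeGierDuminilCopinGuttmann2014, §3.2 (lane plumbing)] -/
theorem stripZ₂C_ofReal (T n : ℕ) (y z : ℝ) : stripZ₂C T n (y : ℂ) (z : ℂ) = ((stripZ₂ T n y z : ℝ) : ℂ) := by
  unfold stripZ₂C stripZ₂
  push_cast
  rfl

/-- **Triangle inequality**: `‖C_{T,n}(w, v)‖ ≤ C_{T,n}(‖w‖, ‖v‖)`. [cite: BeatonBousquetMelouDeGierDuminilCopinGuttmann2014, §3.2 (lane plumbing)] -/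
theorem norm_stripZ₂C_le (T n : ℕ) (w v : ℂ) : ‖stripZ₂C T n w v‖ ≤ stripZ₂ T n ‖w‖ ‖v‖ := by
  unfold stripZ₂C stripZ₂
  refine (norm_sum_le _ _).trans (le_of_eq (Finset.sum_congr rfl fun p _ => ?_))
  rw [norm_mul, norm_pow, norm_pow]

/-- **The complex tilt identity**: `C_{1,N}(y e^u, z) = Σ_q wgt_{y,z}(q) · e^{u·bc(q)}` for every complex `u` (the complex twin of `stripZ₂_one_tilt_eq_sum`).
[cite: DemboZeitouni2010, §2.2 (exponential tilt; lane plumbing); BeatonBousquetMelouDeGierDuminilCopinGuttmann2014, §3.2] -/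
theorem stripZ₂C_one_tilt_eq_sum (y z : ℝ) (u : ℂ) (N : ℕ) :
    stripZ₂C 1 N ((y : ℂ) * cexp u) (z : ℂ) = ∑ q ∈ stripPairs 1 N, (wgt y z N q : ℂ) * cexp (u * (bottomVisits₀ q.1 q.2 N : ℕ)) := by
  unfold stripZ₂C
  refine Finset.sum_congr rfl fun q _ => ?_
  unfold wgt
  push_cast
  rw [mul_pow, ← Complex.exp_nat_mul]
  ring_nf

/-! ## §3 ★★ The characteristic function of the contact law -/

/-- ★★ **THE CHARACTERISTIC FUNCTION OF THE CENTRED, SCALED CONTACT NUMBER**: for `y, z > 0`, every `N` and every real `t`,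
`φ_{contactLaw y z N}(t) = E_{N,y,z} e^{it(bc − Nb)/√N} = C_{1,N}(y e^{it/√N}, z)/C_{1,N}(y, z) · e^{−it√N·b(y,z)}` — the quotient of partition functions at
the COMPLEX fugacity `y e^{it/√N}` (so the Berry–Esseen / local-limit analysis of the contact number is the analysis of `stripZ₂C 1 N (y e^u) z`, `u ∈ ℂ`
small). [cite: Durrett2019, §3.3 Theorem 3.3.1 (lane statement); BeatonBousquetMelouDeGierDuminilCopinGuttmann2014, §3.2 Proposition 6 (arXiv v5 p. 10)] -/
theorem charFun_contactLaw (hy : 0 < y) (hz : 0 < z) (N : ℕ) (t : ℝ) :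
    charFun (contactLaw y z N) t =
      stripZ₂C 1 N ((y : ℂ) * cexp ((t : ℂ) / (Real.sqrt N : ℂ) * I)) (z : ℂ) / ((stripZ₂ 1 N y z : ℝ) : ℂ)
        * cexp (-((t : ℂ) * (Real.sqrt N : ℂ) * (contactB y z : ℂ) * I)) := by
  rw [contactLaw, charFun_finLaw _ _ (wgt_div_nonneg hy hz N), stripZ₂C_one_tilt_eq_sum, Finset.sum_div, Finset.sum_mul]
  refine Finset.sum_congr rfl fun q _ => ?_
  have hsq : (N : ℝ) / Real.sqrt N = Real.sqrt N := Real.div_sqrt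
  have hsqC : ((N : ℝ) : ℂ) / (Real.sqrt N : ℂ) = (Real.sqrt N : ℂ) := by exact_mod_cast congrArg (fun r : ℝ => (r : ℂ)) hsq
  have hexp : cexp ((t : ℂ) * ((((bottomVisits₀ q.1 q.2 N : ℝ) - N * contactB y z) / Real.sqrt N : ℝ) : ℂ) * I)
      = cexp ((t : ℂ) / (Real.sqrt N : ℂ) * I * (bottomVisits₀ q.1 q.2 N : ℕ))
        * cexp (-((t : ℂ) * (Real.sqrt N : ℂ) * (contactB y z : ℂ) * I)) := by
    rw [← Complex.exp_add]
    congr 1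
    push_cast
    have e1 : (t : ℂ) * ((((bottomVisits₀ q.1 q.2 N : ℕ) : ℂ) - (N : ℂ) * (contactB y z : ℂ)) / (Real.sqrt N : ℂ)) * I
        = (t : ℂ) / (Real.sqrt N : ℂ) * I * ((bottomVisits₀ q.1 q.2 N : ℕ) : ℂ)
          - (t : ℂ) * (contactB y z : ℂ) * I * (((N : ℝ) : ℂ) / (Real.sqrt N : ℂ)) := by
      push_cast; ring
    rw [e1, hsqC]
    ring
  rw [hexp]
  push_cast
  ring

end WidthOneYZ

end Literature.Probability.RandomPlanarGeometry.SAW.HexBW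

end
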